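import Summits.ABC.ABC.Theses.CubicResolventAllowance
import HarnessLib

/-!
# STUB-IDEAS `stub_complexCubic` · ideator k1 · generation 8 — the calibration carrier IS Kraus's `(3,3,p)` Frey curve

Crux stmt-ABC-22740 `CubicResolventAllowance.IndexSzpiro`, stub `stub_complexCubic` (the `d_K < 0` half),
route-ABC-CubicResolventAllowance. FAMILY 1 (recognise & import), gen 8. Companion of
`STUB-IDEAS-stub_complexCubic-1.md`; gens 3/6/7 sketches are carried BY REFERENCE
(`StubIdeas1G3Sketch.lean` A6 Mersenne calibration, `StubIdeas1G6Sketch.lean` pencil + `Stub ⟹ abc₈`,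
`StubIdeas1G7Sketch.lean` Cardano H0–H4).

New here (kernel-checked identities only; nothing is claimed toward the stub itself, verdict `open-problem`):
* H6 `pencil_cube_eq_twist_kraus` — on the CUBE sub-pencil `(x, y) = (a³, b³)` the gen-6 pencil
  `E_{x,y} : Y² = X³ + 108xy·X + 216xy(y − x)` is the quadratic twist by `d = 6ab` of KRAUS's Frey curve
  `Y² = X³ + 3abX + b³ − a³` for `a³ + b³ = c^p` [Kraus, Experiment. Math. 7 (1998) 1–13]: `a₄ = d²·3ab`,
  `a₆ = d³·(b³ − a³)`; both have `j = 6912·xy/(x + y)²` (gen-6 T1d).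
* H7 `pencil_cube_root` — the cube sub-pencil has the RATIONAL 2-torsion abscissa `6ab(a − b)` (Kraus: `X = a − b`;
  = gen-7 Cardano root `(α + β)/12`, `α = −72ab²`, `β = 72a²b`). So the reducible fibres ⊇ Kraus fibres and the
  modular-method theorems for signature `(3,3,p)` (Kraus, Bruin, Dahmen, Chen–Siksek) live in the `r ≥ 1` class
  (stmt-ABC-22741), NOT in this stub's class `{xy² ∉ ℚ³}` (which contains the FLT fibres `(a^p, b^p)`, `3 ∤ p`).
-/

set_option linter.dupNamespace false

noncomputable section

namespace Summit.ABC.ABC.Cruxes.IndexSzpiro.StubIdeasComplexCubic1G8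

open Polynomial WeierstrassCurve

/-- The stub, verbatim (payload `stub.signature`). -/
def Stub : Prop :=
  ∀ ε : ℝ, 0 < ε → ∃ C : ℝ, ∀ (W : WeierstrassCurve ℚ) [W.IsElliptic] (K : Type) [Field K] [NumberField K],
    Irreducible W.twoTorsionPolynomial.toPoly → Module.finrank ℚ K = 3 →
    (∃ θ : K, aeval θ W.twoTorsionPolynomial.toPoly = 0) → NumberField.discr K < 0 →
    (W.minimalDiscriminantNorm ℤ : ℝ) ≤ C * |(NumberField.discr K : ℝ)| * (W.conductorNorm ℤ : ℝ) ^ (6 + ε)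

/-- Plumbing (kernel-checked): the route crux gives the stub (drop the sign hypothesis). [folklore] -/
theorem stub_of_indexSzpiro (h : Summit.ABC.ABC.Theses.CubicResolventAllowance.IndexSzpiro) : Stub := by
  intro ε hε
  obtain ⟨C, hC⟩ := h ε hε
  exact ⟨C, fun W _ K _ _ hirr h3 hθ _ => hC W K hirr h3 hθ⟩

/-- Gen-6 pencil, verbatim (`StubIdeas1G6Sketch.pencilInt`): `E_{x,y} : Y² = X³ + 108xy·X + 216xy(y − x)`,
the Frey-like curve of the triple `x + y = z` with `j = 6912xy/z²` and 2-division field `ℚ(∛(xy²))`. -/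
def pencilInt (x y : ℤ) : WeierstrassCurve ℤ := ⟨0, 0, 0, 108 * x * y, 216 * x * y * (y - x)⟩

/-- `E_{x,y}` over `ℚ`. -/
abbrev pencil (x y : ℤ) : WeierstrassCurve ℚ := (pencilInt x y).baseChange ℚ

/-- Kraus's Frey curve for `a³ + b³ = c^p`: `Y² = X³ + 3abX + b³ − a³`
(Δ = −2⁴3³(a³ + b³)², rational 2-torsion point `(a − b, 0)`). [cite: Kraus1998] -/
def kraus (a b : ℤ) : WeierstrassCurve ℚ := ⟨0, 0, 0, 3 * a * b, (b : ℚ) ^ 3 - a ^ 3⟩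

/-- H6 (S, kernel-checked). On the cube sub-pencil the gen-6 pencil is the quadratic twist of Kraus's curve by
`d = 6ab`: `a₄(E_{a³,b³}) = d²·a₄(Kraus)`, `a₆(E_{a³,b³}) = d³·a₆(Kraus)` (and `a₁ = a₂ = a₃ = 0` on both). [folklore] -/
theorem pencil_cube_eq_twist_kraus (a b : ℤ) :
    (pencil (a ^ 3) (b ^ 3)).a₄ = (6 * a * b : ℚ) ^ 2 * (kraus a b).a₄ ∧
    (pencil (a ^ 3) (b ^ 3)).a₆ = (6 * a * b : ℚ) ^ 3 * (kraus a b).a₆ := by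
  simp only [WeierstrassCurve.baseChange, WeierstrassCurve.map_a₄, WeierstrassCurve.map_a₆, pencilInt, kraus,
    algebraMap_int_eq, eq_intCast]
  push_cast
  constructor <;> ring

/-- H7 (S, kernel-checked). The cube sub-pencil has a RATIONAL root of the 2-division cubic:
`ψ₂(E_{a³,b³})(6ab(a − b)) = 0` (Kraus's 2-torsion point `X = a − b`, scaled by the twist `d = 6ab`;
equivalently the gen-7 Cardano root with the rational Cardano pair `(−72ab², 72a²b)`). [folklore] -/
theorem pencil_cube_root (a b : ℤ) :
    aeval (6 * a * b * (a - b) : ℚ) (pencil (a ^ 3) (b ^ 3)).twoTorsionPolynomial.toPoly = 0 := by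
  simp only [WeierstrassCurve.twoTorsionPolynomial, Cubic.toPoly, map_add, map_mul, map_pow, map_ofNat,
    aeval_X, aeval_C]
  simp [WeierstrassCurve.b₂, WeierstrassCurve.b₄, WeierstrassCurve.b₆, pencilInt]
  ring

end Summit.ABC.ABC.Cruxes.IndexSzpiro.StubIdeasComplexCubic1G8

end
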